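import Summits.Parity.GeneralizedHardyLittlewood.Theses.ArtinGenericSplit

/-!
# Route `ArtinGenericSplit` — the `[assembly]` item (stmt-Parity-30688)

decomp-parity node G1.2.A «ArtinGenericSplit» (lens-2 g6; critic CLEARED HOME/STATUS.md l.255, CRITIC-LEDGER
row 54; route born rev 0, commit 5231dbe0a256): the assembly
`BoundedSiegelZeroQuality → FixedUpper → UniformUpperGivenFixed → ArtinTwo → ArtinLift → UniformLowerGivenFixed →
GeneralizedHardyLittlewood` is literally the route's gate-written deciding theorem `closes` (D-0027 §2.1),
curried.  Hand by the cell's prover-class seat; no mathematics beyond the route file.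
-/

namespace Summit.Parity.GeneralizedHardyLittlewood.Theses.ArtinGenericSplit

/-- **The `[assembly]` item holds** (stmt-Parity-30688): the six route items imply
`GeneralizedHardyLittlewood`, by the route's deciding theorem `closes`. -/
theorem assembly_proof : Assembly :=
  fun hQ hFU hUU hA hR hUL => closes hQ hFU hUU hA hR hUL

end Summit.Parity.GeneralizedHardyLittlewood.Theses.ArtinGenericSplit
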